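import Literature.Analysis.OperatorTheory.GroundStateMarkovGap
import HarnessLib

/-!
# Uniqueness, symmetry and variational characterisation of the positive ground state of a strictly positive symmetric kernel
# (Jentzsch / Perron–Frobenius–Kreĭn–Rutman, pointwise form) — PROVED

Topic `Literature/Analysis/OperatorTheory`; theorems only (no definitions, no named facts).  Companion of `PositiveKernelEigenfunction`
(`exists_pointwise_eigenfunction`: for a bounded, jointly measurable, symmetric, strictly positive kernel `K` on a nonzero finite measure space
there is `λ₀ > 0` and an everywhere-positive bounded measurable `h` with `∫ K(x,y)h(y) dμ(y) = λ₀h(x)` for every `x`) and `GroundStateMarkovGap`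
(`toLp_eigenfunction_eq_norm`: such an `h` spans the top eigenspace of the `L²` transfer operator).  Printed source: Reed–Simon IV, Thm XIII.43
(a positivity-improving bounded self-adjoint `A` with `‖A‖` an eigenvalue: `‖A‖` is SIMPLE with a STRICTLY POSITIVE eigenvector) and Thm XIII.44
(the unique positive eigenfunction belongs to the top of the spectrum); Glimm–Jaffe Thm 3.3.2 / Cor 3.3.4 (uniqueness of the ground state).

* ★ `eigenvalue_eq_of_pos_eigenfunctions`, `exists_pos_smul_of_pos_eigenfunctions` — UNIQUENESS: two everywhere-positive bounded measurable pointwise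
  eigenfunctions `∫ K(x,y)hᵢ(y) = λᵢhᵢ(x)` have the SAME eigenvalue and are POSITIVE MULTIPLES of each other EVERYWHERE (`h₂ = c·h₁`, `c > 0`);
  `eq_of_pos_eigenfunctions_of_integral_sq_eq` — equal `L²`-normalisation forces `h₁ = h₂`.
* ★ `comp_eq_of_measurePreserving` — SYMMETRY: if `σ : X → X` is measurable and measure preserving and leaves the kernel invariant,
  `K(σx, σy) = K(x, y)`, then the positive ground state is `σ`-invariant EVERYWHERE, `h ∘ σ = h` (for a lattice gauge transfer kernel: the vacuum
  is gauge invariant and centre-twist invariant, i.e. PHYSICAL, because gauge transformations and twists preserve Haar measure and the kernel).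
* ★ `integral_integral_le_eigenvalue_mul` — VARIATIONAL TOP: for every bounded measurable `ψ`, `∫∫ ψ(x)K(x,y)ψ(y) ≤ λ₀ ∫ ψ²`, with equality at
  `ψ = h` (`integral_integral_eigenfunction`); so `λ₀` is the supremum (indeed the maximum) of the Rayleigh quotient over ANY class of bounded
  measurable functions containing `h` — no smaller class (e.g. «physical» functions) sees a smaller top value once it contains the vacuum.

Use (cell `ym-beyond`, route `LuscherReduction`, crux RED, card `vacuum-chain-transit` support `VacuumExists`/`VacuumData`: `φ₀ > 0` physical with
`qform φ₀ φ₀ = topValue · l2 φ₀ φ₀`; and ONE: «`topValue` IS an attained simple eigenvalue with a physical eigenfunction»): `X` = link configurations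
with the product Haar measure, `K = K_β` the transfer kernel (continuous, bounded, symmetric, `> 0` on a compact group), `σ` = a gauge transformation or
a centre twist.

## References
* M. Reed, B. Simon, *Methods of Modern Mathematical Physics IV*, Academic Press 1978, Thm XIII.43, Thm XIII.44. [ReedSimonIV1978]
* J. Glimm, A. Jaffe, *Quantum Physics*, 2nd ed., Springer 1987, Thm 3.3.2, Cor 3.3.4. [GlimmJaffe1987]
-/

noncomputable section

open MeasureTheory Set Filter Function
open scoped RealInnerProductSpace ENNReal

namespace Literature.Analysis.OperatorTheory.PositiveKernelGroundState

open Literature.Analysis.OperatorTheory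

variable {X : Type*} [MeasurableSpace X] {μ : Measure X} [IsFiniteMeasure μ]
variable {K : X → X → ℝ} {C : ℝ}

/-- The section `y ↦ K(x, y)·f(y)` of a jointly measurable kernel against a measurable `f` is measurable. [folklore] -/
private theorem measurable_kernel_section_mul (hK : StronglyMeasurable (uncurry K)) {f : X → ℝ} (hf : Measurable f)
    (x : X) : Measurable fun y => K x y * f y := by
  have h1 : Measurable fun y => uncurry K (x, y) := hK.measurable.comp (measurable_const.prodMk measurable_id)
  exact h1.mul hf

/-- ★ **Uniqueness of the eigenvalue of a positive eigenfunction** (Reed–Simon XIII.44, pointwise form): two everywhere-positive bounded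
measurable pointwise eigenfunctions of a bounded, jointly measurable, symmetric, strictly positive kernel on a nonzero finite measure space have
the same eigenvalue (namely the norm of the transfer operator). [cite: ReedSimonIV1978, Thm XIII.43 and Thm XIII.44] -/
theorem eigenvalue_eq_of_pos_eigenfunctions (hK : StronglyMeasurable (uncurry K))
    (hC : ∀ x y, ‖K x y‖ ≤ C) (hsymm : ∀ x y, K x y = K y x) (hpos : ∀ x y, 0 < K x y) (hμ : μ ≠ 0)
    {lam₁ lam₂ : ℝ} {h₁ h₂ : X → ℝ} (hm₁ : Measurable h₁) (hm₂ : Measurable h₂)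
    (hp₁ : ∀ x, 0 < h₁ x) (hp₂ : ∀ x, 0 < h₂ x) {B₁ B₂ : ℝ} (hb₁ : ∀ x, ‖h₁ x‖ ≤ B₁) (hb₂ : ∀ x, ‖h₂ x‖ ≤ B₂)
    (he₁ : ∀ x, ∫ y, K x y * h₁ y ∂μ = lam₁ * h₁ x) (he₂ : ∀ x, ∫ y, K x y * h₂ y ∂μ = lam₂ * h₂ x) :
    lam₁ = lam₂ := by
  obtain ⟨A, hA, hsa, hcpt, himp, hA0⟩ := exists_transferOperator (μ := μ) hK hC hsymm hpos hμ
  obtain ⟨φ₀, -, hφ₀pos, hAφ₀, hsimple, -⟩ := himp.exists_spectralGap hsa hcpt hA0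
  obtain ⟨-, hl₁, -, -⟩ := toLp_eigenfunction_eq_norm hμ hA hsa hφ₀pos hAφ₀ hsimple hm₁ hp₁ hb₁ he₁
  obtain ⟨-, hl₂, -, -⟩ := toLp_eigenfunction_eq_norm hμ hA hsa hφ₀pos hAφ₀ hsimple hm₂ hp₂ hb₂ he₂
  rw [hl₁, hl₂]

/-- The eigenvalue of a positive eigenfunction of a strictly positive kernel is positive. [cite: ReedSimonIV1978, Thm XIII.43 and Thm XIII.44] -/
theorem eigenvalue_pos_of_pos_eigenfunction (hpos : ∀ x y, 0 < K x y) (hμ : μ ≠ 0)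
    {lam : ℝ} {h : X → ℝ} (hm : Measurable h) (hp : ∀ x, 0 < h x) {B : ℝ} (hb : ∀ x, ‖h x‖ ≤ B)
    (he : ∀ x, ∫ y, K x y * h y ∂μ = lam * h x) (hK : StronglyMeasurable (uncurry K)) (hC : ∀ x y, ‖K x y‖ ≤ C) :
    0 < lam := by
  have hne : μ univ ≠ 0 := fun h0 => hμ (Measure.measure_univ_eq_zero.1 h0)
  obtain ⟨x, -⟩ := nonempty_of_measure_ne_zero hne
  have hint : Integrable (fun y => K x y * h y) μ := by
    refine Integrable.mono' (integrable_const (C * B)) (measurable_kernel_section_mul hK hm x).aestronglyMeasurable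
      (Eventually.of_forall fun y => ?_)
    rw [norm_mul]
    exact mul_le_mul (hC x y) (hb y) (norm_nonneg _) ((norm_nonneg _).trans (hC x y))
  have hI : 0 < ∫ y, K x y * h y ∂μ := by
    rw [integral_pos_iff_support_of_nonneg_ae (Eventually.of_forall fun y => (mul_pos (hpos x y) (hp y)).le) hint]
    have hs : support (fun y => K x y * h y) = univ := by
      ext y
      simp only [mem_support, ne_eq, mul_eq_zero, not_or, mem_univ, iff_true]
      exact ⟨(hpos x y).ne', (hp y).ne'⟩
    rw [hs]; exact pos_iff_ne_zero.mpr hne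
  rw [he x] at hI
  exact pos_of_mul_pos_left hI (hp x).le

/-- ★ **Uniqueness of the positive ground state up to a positive factor** (Reed–Simon XIII.43 simplicity + XIII.44, pointwise form): two
everywhere-positive bounded measurable pointwise eigenfunctions satisfy `h₂ = c·h₁` EVERYWHERE for some `c > 0`.
[cite: ReedSimonIV1978, Thm XIII.43 and Thm XIII.44] -/
theorem exists_pos_smul_of_pos_eigenfunctions (hK : StronglyMeasurable (uncurry K))
    (hC : ∀ x y, ‖K x y‖ ≤ C) (hsymm : ∀ x y, K x y = K y x) (hpos : ∀ x y, 0 < K x y) (hμ : μ ≠ 0)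
    {lam₁ lam₂ : ℝ} {h₁ h₂ : X → ℝ} (hm₁ : Measurable h₁) (hm₂ : Measurable h₂)
    (hp₁ : ∀ x, 0 < h₁ x) (hp₂ : ∀ x, 0 < h₂ x) {B₁ B₂ : ℝ} (hb₁ : ∀ x, ‖h₁ x‖ ≤ B₁) (hb₂ : ∀ x, ‖h₂ x‖ ≤ B₂)
    (he₁ : ∀ x, ∫ y, K x y * h₁ y ∂μ = lam₁ * h₁ x) (he₂ : ∀ x, ∫ y, K x y * h₂ y ∂μ = lam₂ * h₂ x) :
    ∃ c : ℝ, 0 < c ∧ ∀ x, h₂ x = c * h₁ x := by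
  obtain ⟨A, hA, hsa, hcpt, himp, hA0⟩ := exists_transferOperator (μ := μ) hK hC hsymm hpos hμ
  obtain ⟨φ₀, -, hφ₀pos, hAφ₀, hsimple, -⟩ := himp.exists_spectralGap hsa hcpt hA0
  obtain ⟨-, hl₁, hc₁, hprop₁⟩ := toLp_eigenfunction_eq_norm hμ hA hsa hφ₀pos hAφ₀ hsimple hm₁ hp₁ hb₁ he₁
  obtain ⟨-, hl₂, hc₂, hprop₂⟩ := toLp_eigenfunction_eq_norm hμ hA hsa hφ₀pos hAφ₀ hsimple hm₂ hp₂ hb₂ he₂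
  set L₁ : Lp ℝ 2 μ := (memLp_two_of_bound (μ := μ) hm₁ hb₁).toLp h₁ with hL₁
  set L₂ : Lp ℝ 2 μ := (memLp_two_of_bound (μ := μ) hm₂ hb₂).toLp h₂ with hL₂
  set c₁ : ℝ := ⟪φ₀, L₁⟫ with hc₁def
  set c₂ : ℝ := ⟪φ₀, L₂⟫ with hc₂def
  have hlam : 0 < lam₂ := eigenvalue_pos_of_pos_eigenfunction hpos hμ hm₂ hp₂ hb₂ he₂ hK hC
  -- `[h₂] = (c₂/c₁) • [h₁]` in `L²`
  have hL : L₂ = (c₂ / c₁) • L₁ := by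
    rw [hprop₂, hprop₁, smul_smul, div_mul_cancel₀ _ hc₁.ne']
  -- hence a.e.
  have hae : h₂ =ᵐ[μ] fun x => (c₂ / c₁) * h₁ x := by
    have e1 : (L₂ : X → ℝ) =ᵐ[μ] h₂ := MemLp.coeFn_toLp _
    have e2 : (L₁ : X → ℝ) =ᵐ[μ] h₁ := MemLp.coeFn_toLp _
    have e3 : ((c₂ / c₁) • L₁ : Lp ℝ 2 μ) =ᵐ[μ] fun x => (c₂ / c₁) * (L₁ : X → ℝ) x := by
      filter_upwards [Lp.coeFn_smul (c₂ / c₁) L₁] with x hx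
      rw [hx, Pi.smul_apply, smul_eq_mul]
    rw [← hL] at e3
    filter_upwards [e1, e2, e3] with x hx1 hx2 hx3
    rw [← hx1, hx3, hx2]
  -- and everywhere, through the eigen-equation
  refine ⟨c₂ / c₁, div_pos hc₂ hc₁, fun x => ?_⟩
  have e : ∫ y, K x y * h₂ y ∂μ = (c₂ / c₁) * ∫ y, K x y * h₁ y ∂μ := by
    rw [← integral_const_mul]
    refine integral_congr_ae ?_
    filter_upwards [hae] with y hy
    rw [hy]; ring
  rw [he₂ x, he₁ x, eigenvalue_eq_of_pos_eigenfunctions hK hC hsymm hpos hμ hm₁ hm₂ hp₁ hp₂ hb₁ hb₂ he₁ he₂] at e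
  have h' : lam₂ * h₂ x = lam₂ * (c₂ / c₁ * h₁ x) := by rw [e]; ring
  exact mul_left_cancel₀ hlam.ne' h'

/-- Two positive ground states with the same `L²` normalisation COINCIDE everywhere. [cite: ReedSimonIV1978, Thm XIII.43 and Thm XIII.44] -/
theorem eq_of_pos_eigenfunctions_of_integral_sq_eq (hK : StronglyMeasurable (uncurry K))
    (hC : ∀ x y, ‖K x y‖ ≤ C) (hsymm : ∀ x y, K x y = K y x) (hpos : ∀ x y, 0 < K x y) (hμ : μ ≠ 0)
    {lam₁ lam₂ : ℝ} {h₁ h₂ : X → ℝ} (hm₁ : Measurable h₁) (hm₂ : Measurable h₂)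
    (hp₁ : ∀ x, 0 < h₁ x) (hp₂ : ∀ x, 0 < h₂ x) {B₁ B₂ : ℝ} (hb₁ : ∀ x, ‖h₁ x‖ ≤ B₁) (hb₂ : ∀ x, ‖h₂ x‖ ≤ B₂)
    (he₁ : ∀ x, ∫ y, K x y * h₁ y ∂μ = lam₁ * h₁ x) (he₂ : ∀ x, ∫ y, K x y * h₂ y ∂μ = lam₂ * h₂ x)
    (hsq : ∫ x, h₁ x ^ 2 ∂μ = ∫ x, h₂ x ^ 2 ∂μ) : ∀ x, h₁ x = h₂ x := by
  obtain ⟨c, hc, hch⟩ := exists_pos_smul_of_pos_eigenfunctions hK hC hsymm hpos hμ hm₁ hm₂ hp₁ hp₂ hb₁ hb₂ he₁ he₂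
  -- `∫ h₂² = c² ∫ h₁²` and `∫ h₁² > 0` force `c = 1`
  have hint₁ : Integrable (fun x => h₁ x ^ 2) μ := by
    have := (memLp_two_of_bound (μ := μ) hm₁ hb₁).integrable_sq
    exact this
  have hI : ∫ x, h₂ x ^ 2 ∂μ = c ^ 2 * ∫ x, h₁ x ^ 2 ∂μ := by
    rw [← integral_const_mul]
    refine integral_congr_ae (Eventually.of_forall fun x => ?_)
    show h₂ x ^ 2 = c ^ 2 * h₁ x ^ 2
    rw [hch x]; ring
  have hpos₁ : 0 < ∫ x, h₁ x ^ 2 ∂μ := by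
    have hne : μ univ ≠ 0 := fun h0 => hμ (Measure.measure_univ_eq_zero.1 h0)
    rw [integral_pos_iff_support_of_nonneg_ae (Eventually.of_forall fun x => sq_nonneg (h₁ x)) hint₁]
    have hs : support (fun x => h₁ x ^ 2) = univ := by
      ext x
      simp only [mem_support, ne_eq, mem_univ, iff_true]
      exact pow_ne_zero 2 (hp₁ x).ne'
    rw [hs]; exact pos_iff_ne_zero.mpr hne
  have hc1 : c = 1 := by
    have h1 : c ^ 2 = 1 := by
      have : c ^ 2 * ∫ x, h₁ x ^ 2 ∂μ = 1 * ∫ x, h₁ x ^ 2 ∂μ := by rw [← hI, one_mul, hsq]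
      exact mul_right_cancel₀ hpos₁.ne' this
    nlinarith [hc]
  intro x
  rw [hch x, hc1, one_mul]

/-- ★ **Symmetry of the ground state** (Perron–Frobenius uniqueness ⟹ invariance): if `σ : X → X` is measurable, MEASURE PRESERVING and leaves
the kernel invariant, `K(σx, σy) = K(x,y)`, then every everywhere-positive bounded measurable pointwise eigenfunction is `σ`-invariant EVERYWHERE:
`h(σx) = h(x)`.  (`h ∘ σ` is again a positive normalised pointwise eigenfunction; apply uniqueness.)  For a lattice gauge transfer kernel: the vacuum
is gauge and centre-twist invariant. [cite: ReedSimonIV1978, Thm XIII.43 and Thm XIII.44] [cite: GlimmJaffe1987, Cor 3.3.4] -/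
theorem comp_eq_of_measurePreserving (hK : StronglyMeasurable (uncurry K))
    (hC : ∀ x y, ‖K x y‖ ≤ C) (hsymm : ∀ x y, K x y = K y x) (hpos : ∀ x y, 0 < K x y) (hμ : μ ≠ 0)
    {σ : X → X} (hσ : MeasurePreserving σ μ μ) (hKσ : ∀ x y, K (σ x) (σ y) = K x y)
    {lam : ℝ} {h : X → ℝ} (hm : Measurable h) (hp : ∀ x, 0 < h x) {B : ℝ} (hb : ∀ x, ‖h x‖ ≤ B)
    (he : ∀ x, ∫ y, K x y * h y ∂μ = lam * h x) : ∀ x, h (σ x) = h x := by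
  have hσm : Measurable σ := hσ.measurable
  -- `h ∘ σ` is a positive bounded measurable pointwise eigenfunction with the same eigenvalue
  have hm' : Measurable (h ∘ σ) := hm.comp hσm
  have hp' : ∀ x, 0 < (h ∘ σ) x := fun x => hp (σ x)
  have hb' : ∀ x, ‖(h ∘ σ) x‖ ≤ B := fun x => hb (σ x)
  have he' : ∀ x, ∫ y, K x y * (h ∘ σ) y ∂μ = lam * (h ∘ σ) x := by
    intro x
    have hmeas : AEStronglyMeasurable (fun y => K (σ x) y * h y) (Measure.map σ μ) :=
      (measurable_kernel_section_mul hK hm (σ x)).aestronglyMeasurable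
    calc ∫ y, K x y * (h ∘ σ) y ∂μ = ∫ y, K (σ x) (σ y) * h (σ y) ∂μ := by
          refine integral_congr_ae (Eventually.of_forall fun y => ?_); simp [hKσ]
      _ = ∫ y, K (σ x) y * h y ∂(Measure.map σ μ) := (integral_map hσm.aemeasurable hmeas).symm
      _ = ∫ y, K (σ x) y * h y ∂μ := by rw [hσ.map_eq]
      _ = lam * (h ∘ σ) x := he (σ x)
  -- same `L²` normalisation, by measure preservation
  have hsq : ∫ x, h x ^ 2 ∂μ = ∫ x, (h ∘ σ) x ^ 2 ∂μ := by
    have hmeas : AEStronglyMeasurable (fun y => h y ^ 2) (Measure.map σ μ) := (hm.pow_const 2).aestronglyMeasurable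
    calc ∫ x, h x ^ 2 ∂μ = ∫ x, h x ^ 2 ∂(Measure.map σ μ) := by rw [hσ.map_eq]
      _ = ∫ x, (h ∘ σ) x ^ 2 ∂μ := integral_map hσm.aemeasurable hmeas
  intro x
  exact (eq_of_pos_eigenfunctions_of_integral_sq_eq hK hC hsymm hpos hμ hm hm' hp hp' hb hb' he he' hsq x).symm

omit [IsFiniteMeasure μ] in
/-- The Rayleigh quotient of the ground state is its eigenvalue: `∫∫ h(x)K(x,y)h(y) = λ ∫ h²`. [cite: ReedSimonIV1978, Thm XIII.44] -/
theorem integral_integral_eigenfunction {lam : ℝ} {h : X → ℝ} (he : ∀ x, ∫ y, K x y * h y ∂μ = lam * h x) :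
    ∫ x, ∫ y, h x * K x y * h y ∂μ ∂μ = lam * ∫ x, h x ^ 2 ∂μ := by
  rw [← integral_const_mul]
  refine integral_congr_ae (Eventually.of_forall fun x => ?_)
  show ∫ y, h x * K x y * h y ∂μ = lam * h x ^ 2
  have e : ∫ y, h x * K x y * h y ∂μ = h x * ∫ y, K x y * h y ∂μ := by
    rw [← integral_const_mul]
    refine integral_congr_ae (Eventually.of_forall fun y => ?_); ring
  rw [e, he x]; ring

/-- ★ **Variational characterisation of the top** (min–max, level `0`): if a bounded measurable everywhere-positive `h` is a pointwise eigenfunction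
with eigenvalue `λ` of a bounded, jointly measurable, symmetric, strictly positive kernel on a nonzero finite measure space, then for EVERY bounded
measurable `ψ`: `∫∫ ψ(x)K(x,y)ψ(y) ≤ λ ∫ ψ²` (`λ = ‖A‖`, Cauchy–Schwarz in `L²`).  With `integral_integral_eigenfunction`: `λ` is the MAXIMUM of the
Rayleigh quotient over any class of bounded measurable functions containing `h`. [cite: ReedSimonIV1978, Thm XIII.1 and Thm XIII.44] -/
theorem integral_integral_le_eigenvalue_mul (hK : StronglyMeasurable (uncurry K))
    (hC : ∀ x y, ‖K x y‖ ≤ C) (hsymm : ∀ x y, K x y = K y x) (hpos : ∀ x y, 0 < K x y) (hμ : μ ≠ 0)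
    {lam : ℝ} {h : X → ℝ} (hm : Measurable h) (hp : ∀ x, 0 < h x) {B : ℝ} (hb : ∀ x, ‖h x‖ ≤ B)
    (he : ∀ x, ∫ y, K x y * h y ∂μ = lam * h x)
    {ψ : X → ℝ} (hψm : Measurable ψ) {M : ℝ} (hψb : ∀ x, ‖ψ x‖ ≤ M) :
    ∫ x, ∫ y, ψ x * K x y * ψ y ∂μ ∂μ ≤ lam * ∫ x, ψ x ^ 2 ∂μ := by
  obtain ⟨A, hA, hsa, hcpt, himp, hA0⟩ := exists_transferOperator (μ := μ) hK hC hsymm hpos hμ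
  obtain ⟨φ₀, -, hφ₀pos, hAφ₀, hsimple, -⟩ := himp.exists_spectralGap hsa hcpt hA0
  obtain ⟨-, hl, -, -⟩ := toLp_eigenfunction_eq_norm hμ hA hsa hφ₀pos hAφ₀ hsimple hm hp hb he
  set Ψ : Lp ℝ 2 μ := (memLp_two_of_bound (μ := μ) hψm hψb).toLp ψ with hΨ
  have hcoe : (Ψ : X → ℝ) =ᵐ[μ] ψ := MemLp.coeFn_toLp _
  -- `⟪Ψ, AΨ⟫ ≤ ‖A‖ ‖Ψ‖²`
  have h1 : ⟪Ψ, A Ψ⟫ ≤ ‖A‖ * ‖Ψ‖ ^ 2 := by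
    calc ⟪Ψ, A Ψ⟫ ≤ ‖Ψ‖ * ‖A Ψ‖ := real_inner_le_norm _ _
      _ ≤ ‖Ψ‖ * (‖A‖ * ‖Ψ‖) := by gcongr; exact A.le_opNorm Ψ
      _ = ‖A‖ * ‖Ψ‖ ^ 2 := by ring
  -- `⟪Ψ, AΨ⟫ = ∫∫ ψ K ψ`
  have h2 : ⟪Ψ, A Ψ⟫ = ∫ x, ∫ y, ψ x * K x y * ψ y ∂μ ∂μ := by
    rw [inner_kernelOp_eq_integral hA Ψ Ψ]
    refine integral_congr_ae ?_
    filter_upwards [hcoe] with x hx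
    rw [hx, ← integral_const_mul]
    refine integral_congr_ae ?_
    filter_upwards [hcoe] with y hy
    rw [hy]; ring
  -- `‖Ψ‖² = ∫ ψ²`
  have h3 : ‖Ψ‖ ^ 2 = ∫ x, ψ x ^ 2 ∂μ := by
    rw [← real_inner_self_eq_norm_sq, inner_eq_integral]
    refine integral_congr_ae ?_
    filter_upwards [hcoe] with x hx
    rw [hx]; ring
  rw [← h2, ← h3, hl]
  exact h1

end Literature.Analysis.OperatorTheory.PositiveKernelGroundState

end
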